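import Summits.BirchSwinnertonDyer.BirchSwinnertonDyer.Theorems.SchneiderFreeAdditiveX3PoitouTatePresentationPairingGlobal
import HarnessLib

/-!
# Poitou–Tate toolkit: SIGN-FREE forms of the (R4) reductions — only «local terms sum to zero ⟹ inv(ŷ ∘ ∂(f ≫ g)) = 0»
# is consumed, so the E-side reciprocity sum may be proved with either global sign convention

Cell `bsd-schneider-ideate`, seat `bsd-schneider-door-c6` (prover, generation 17).  PARTITION: board row
B6 ∩ X3 ∩ sst-twist, `r = 1`, of `Rank1Residual.partition` — CONTROL corner (crux `AnticycControlAdditiveK`,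
stmt-BirchSwinnertonDyer-19295; facts binder `ControlFacts` (i) = `poitouTate_selmerStructure_duality K`).
bears_on: K1-door (r1, B6∩X3-sst) (route-BirchSwinnertonDyer-SchneiderFreeAdditiveX3 item 18969).  THEOREMS ONLY;
closes nothing by itself (BSD is not advanced; no case of Poitou–Tate is proved here).

`hR4_of_localTerms` / `hR4_of_globalTerms` (`…PresentationPairing`, `…PresentationPairingGlobal`) take the E-side
reciprocity sum as an EQUALITY `inv(ŷ ∘ ∂(f ≫ g)) = Σ_v term_v` with one fixed sign.  The deduction of (R4) only uses
«`Σ_{v ∈ T'} term_v = 0 ⟹ inv(ŷ ∘ ∂(f ≫ g)) = 0`», which follows from the equality with EITHER sign (the Yoneda /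
connecting-map conventions of door-c4's `Ext` side and of the native `δ₁` may differ by a global sign; Milne ADT I
p. 58 has `⟨β¹(c), y⟩ = −Σ_v inv_v(δ₀h_v ∪ y_v)` in one convention).  This file records the sign-free forms, with the
same local terms (finite places: `− brauerInvariantEquiv K_v (…)` via `HomDualLocalPairing(Global)`; infinite places:
`zmodToQmodZ n ⟨R_w f, loc_w ·⟩_w`):
* **`hR4_of_localTerms_of_imp`**, **`hR4_of_globalTerms_of_imp`** — (R4) for the readout;
* **`poitouTate_selmerStructure_duality_of_globalTerms_of_imp`** — hE from {`TateDualityHypotheses (classBarD K) inv`,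
  an idèle projection family with the ASSEMBLY property, the sign-free E-side statement in global terms}.

References: [MilneADT2006] I Thm. 4.10 (b) (proof, p. 58), Lemma 4.13, Prop. 0.19; [CasselsFrohlichANT1967] Ch. VII
§11.2 (bis); [NeukirchSchmidtWingberg2008] (1.4.2)–(1.5.2).
-/
noncomputable section

open Function NumberField IsDedekindDomain CategoryTheory CategoryTheory.Abelian
open scoped NumberField ContRepresentation

set_option linter.dupNamespace false
set_option autoImplicit false

namespace Summit.BirchSwinnertonDyer.BirchSwinnertonDyer.Theorems.SchneiderFreeAdditiveX3.PoitouTateReduction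

open Field
open Literature.NumberTheory.GaloisRepresentations Literature.NumberTheory.GaloisCohomology
open Literature.NumberTheory.GaloisRepresentations.DiscreteGaloisModule (mu TateDual tateDual
  localTatePairingZMod unramifiedSubgroup)
open Literature.Algebra.Homology Literature.Algebra.Homology.DiscreteRep Literature.Algebra.Homology.ExtPresentation
open Literature.NumberTheory.GaloisRepresentations.IdeleClassBar (classBarD)
open Literature.NumberTheory.GaloisRepresentations.FreePresentation (presentationComplex presentationComplex_shortExact
  presModule₁ presModule₂ presIncl presProj pres_isSES moduleFinite_presModule₁ moduleFinite_presModule₂)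
open Literature.NumberTheory.GaloisRepresentations.HomDual (IdeleProjection readout readoutInvariant localReadout
  readout_eq_localReadout charZero_of_algebra equivariantMap restrictIntertwining isSES_restrict
  zmodToQmodZ_localTatePairingZMod_localReadout map_map_res_eq_res res_δ₁_presentation)
open Literature.NumberTheory.GaloisRepresentations.DGMBridge (LCarrier)
open Literature.AnabelianGeometry.AbsoluteAnabelian.Prop121vii (zmodToQmodZ brauerInvariantEquiv)

variable {K : Type} [Field K] [NumberField K]
variable (inv : Abelian.Ext (triv (Γ := absoluteGaloisGroup K) ℤ) (classBarD K) 2 →+ AddCircle (1 : ℚ))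


/-- **(R4) for the readout from the SIGN-FREE local-terms statement** (`y ∈ H¹(K, M₀^{DD})`, inverse-of-biduality `κ`):
«`Σ_{v∈T'} term_v = 0 ⟹ inv(ŷ ∘ ∂(f ≫ g)) = 0`».
[cite: MilneADT2006, Ch. I, Thm. 4.10(b) (proof, p. 58), §1][cite: CasselsFrohlichANT1967, Ch. VII §11.2 (bis)] -/
theorem hR4_of_localTerms_of_imp (π : ∀ v : Place K, IdeleProjection K v)
    {n : ℕ} [NeZero n] {M : Type} [AddCommGroup M] [TopologicalSpace M] [DiscreteTopology M] [Finite M]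
    [Finite (TateDual K M n)] (ρ₀ : DiscreteGaloisModule K M) (hM : ∀ m : M, n • m = 0)
    (κ : ((ρ₀.tateDual n).tateDual n).toContRepresentation →ⁱL ρ₀.toContRepresentation)
    (hκ : ∀ (Φ : TateDual K (TateDual K M n) n) (f : TateDual K M n), Φ f = f (κ Φ))
    (hE : ∀ (f : (presentationComplex ρ₀).X₁ ⟶ (ideleClassLimitShortComplex K).X₂)
      (ŷ : Abelian.Ext (triv (Γ := absoluteGaloisGroup K) ℤ) (presentationComplex ρ₀).X₃ 1) (T₀ : Finset (Place K)),
      ∃ (y : galoisCohomology ((ρ₀.tateDual n).tateDual n) 1) (Ty : Finset (Place K)), T₀ ⊆ Ty ∧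
        (∀ v : HeightOneSpectrum (𝓞 K), (Sum.inr v : Place K) ∉ Ty →
          galoisCohomology.localization ((ρ₀.tateDual n).tateDual n) (Sum.inr v) 1 y ∈
            unramifiedSubgroup (GaloisRep.toLocal v ((ρ₀.tateDual n).tateDual n)) 1) ∧
        ∀ T' : Finset (Place K), Ty ⊆ T' →
          (∑ v ∈ T', Sum.elim
            (fun w : InfinitePlace K => zmodToQmodZ n
              (localTatePairingZMod (ρ₀.tateDual n) n (Sum.inl w) (LocalInvariants.canonical K n (Sum.inl w))
                (readout ρ₀ n hM (π (Sum.inl w)) f)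
                (galoisCohomology.localization ((ρ₀.tateDual n).tateDual n) (Sum.inl w) 1 y)))
            (fun v : HeightOneSpectrum (𝓞 K) =>
              haveI := moduleFinite_presModule₁ ρ₀
              haveI := moduleFinite_presModule₂ ρ₀
              haveI : CharZero (v.adicCompletion K) := charZero_of_algebra (K := K) (v.adicCompletion K);
              - brauerInvariantEquiv (v.adicCompletion K)
                (cohomologyMap (toTopRepHom ((presModule₁ ρ₀).restrictField (v.adicCompletion K))
                    (DiscreteGaloisModule.units (v.adicCompletion K))
                    (equivariantMap ((presModule₁ ρ₀).restrictField (v.adicCompletion K))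
                      (DiscreteGaloisModule.units (v.adicCompletion K))
                      (readoutInvariant (π (Sum.inr v)) (presentationComplex ρ₀).X₁ f))) 2
                  ((isSES_restrict (presModule₁ ρ₀) (presModule₂ ρ₀) ρ₀ (pres_isSES ρ₀) (K' := v.adicCompletion K)).δ₁
                    (galoisCohomology.map (κ.restrictField (v.adicCompletion K)) 1
                      (galoisCohomology.localization ((ρ₀.tateDual n).tateDual n) (Sum.inr v) 1 y)))))
            v) = 0 →
          inv (ŷ.comp (boundary (presentationComplex_shortExact ρ₀) (classBarD K)
            (f ≫ (ideleClassLimitShortComplex K).g)) (rfl : 1 + 1 = 2)) = 0) :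
    ∀ (f : (presentationComplex ρ₀).X₁ ⟶ (ideleClassLimitShortComplex K).X₂)
      (ŷ : Abelian.Ext (triv (Γ := absoluteGaloisGroup K) ℤ) (presentationComplex ρ₀).X₃ 1) (T₀ : Finset (Place K)),
      ∃ (y : galoisCohomology ((ρ₀.tateDual n).tateDual n) 1) (Ty : Finset (Place K)), T₀ ⊆ Ty ∧
        (∀ v : HeightOneSpectrum (𝓞 K), (Sum.inr v : Place K) ∉ Ty →
          galoisCohomology.localization ((ρ₀.tateDual n).tateDual n) (Sum.inr v) 1 y ∈
            unramifiedSubgroup (GaloisRep.toLocal v ((ρ₀.tateDual n).tateDual n)) 1) ∧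
        ((∀ T' : Finset (Place K), Ty ⊆ T' →
            ∑ v ∈ T', localTatePairingZMod (ρ₀.tateDual n) n v (LocalInvariants.canonical K n v)
              (readout ρ₀ n hM (π v) f)
              (galoisCohomology.localization ((ρ₀.tateDual n).tateDual n) v 1 y) = 0) →
          inv (ŷ.comp (boundary (presentationComplex_shortExact ρ₀) (classBarD K)
            (f ≫ (ideleClassLimitShortComplex K).g)) (rfl : 1 + 1 = 2)) = 0) := by
  intro f ŷ T₀
  haveI := moduleFinite_presModule₁ ρ₀
  haveI := moduleFinite_presModule₂ ρ₀
  obtain ⟨y, Ty, hT, hunr, himp⟩ := hE f ŷ T₀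
  refine ⟨y, Ty, hT, hunr, fun hzero => himp Ty le_rfl ?_⟩
  have hterm : ∀ v ∈ Ty, (Sum.elim
      (fun w : InfinitePlace K => zmodToQmodZ n
        (localTatePairingZMod (ρ₀.tateDual n) n (Sum.inl w) (LocalInvariants.canonical K n (Sum.inl w))
          (readout ρ₀ n hM (π (Sum.inl w)) f)
          (galoisCohomology.localization ((ρ₀.tateDual n).tateDual n) (Sum.inl w) 1 y)))
      (fun v : HeightOneSpectrum (𝓞 K) =>
        haveI := moduleFinite_presModule₁ ρ₀
        haveI := moduleFinite_presModule₂ ρ₀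
        haveI : CharZero (v.adicCompletion K) := charZero_of_algebra (K := K) (v.adicCompletion K);
        - brauerInvariantEquiv (v.adicCompletion K)
          (cohomologyMap (toTopRepHom ((presModule₁ ρ₀).restrictField (v.adicCompletion K))
              (DiscreteGaloisModule.units (v.adicCompletion K))
              (equivariantMap ((presModule₁ ρ₀).restrictField (v.adicCompletion K))
                (DiscreteGaloisModule.units (v.adicCompletion K))
                (readoutInvariant (π (Sum.inr v)) (presentationComplex ρ₀).X₁ f))) 2
            ((isSES_restrict (presModule₁ ρ₀) (presModule₂ ρ₀) ρ₀ (pres_isSES ρ₀) (K' := v.adicCompletion K)).δ₁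
              (galoisCohomology.map (κ.restrictField (v.adicCompletion K)) 1
                (galoisCohomology.localization ((ρ₀.tateDual n).tateDual n) (Sum.inr v) 1 y)))))
      v : AddCircle (1 : ℚ)) =
      zmodToQmodZ n (localTatePairingZMod (ρ₀.tateDual n) n v (LocalInvariants.canonical K n v)
        (readout ρ₀ n hM (π v) f) (galoisCohomology.localization ((ρ₀.tateDual n).tateDual n) v 1 y)) := by
    rintro (w | v) -
    · rfl
    · haveI : CharZero (v.adicCompletion K) := charZero_of_algebra (K := K) (v.adicCompletion K)
      set yv : galoisCohomology (((ρ₀.tateDual n).tateDual n).restrictField (v.adicCompletion K)) 1 :=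
        galoisCohomology.localization ((ρ₀.tateDual n).tateDual n) (Sum.inr v) 1 y with hyv
      exact (zmodToQmodZ_localTatePairingZMod_localReadout ρ₀ n hM v κ hκ
        (readoutInvariant (π (Sum.inr v)) (presentationComplex ρ₀).X₁ f) yv).symm
  rw [Finset.sum_congr rfl hterm, ← map_sum, hzero Ty le_rfl, map_zero]

/-- **(R4) for the readout from the SIGN-FREE statement in GLOBAL terms** (`x ∈ H¹(K, M₀)`, the global `δ₁^K`).
[cite: MilneADT2006, Ch. I, Thm. 4.10(b) (proof, p. 58), Prop. 0.19][cite: CasselsFrohlichANT1967, Ch. VII §11.2 (bis)] -/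
theorem hR4_of_globalTerms_of_imp (π : ∀ v : Place K, IdeleProjection K v)
    {n : ℕ} [NeZero n] {M : Type} [AddCommGroup M] [TopologicalSpace M] [DiscreteTopology M] [Finite M]
    [Finite (TateDual K M n)] (ρ₀ : DiscreteGaloisModule K M) (hM : ∀ m : M, n • m = 0)
    (ι : ρ₀.toContRepresentation →ⁱL ((ρ₀.tateDual n).tateDual n).toContRepresentation)
    (κ : ((ρ₀.tateDual n).tateDual n).toContRepresentation →ⁱL ρ₀.toContRepresentation)
    (hκι : ∀ m : M, κ (ι m) = m)
    (hκ : ∀ (Φ : TateDual K (TateDual K M n) n) (f : TateDual K M n), Φ f = f (κ Φ))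
    (hE : ∀ (f : (presentationComplex ρ₀).X₁ ⟶ (ideleClassLimitShortComplex K).X₂)
      (ŷ : Abelian.Ext (triv (Γ := absoluteGaloisGroup K) ℤ) (presentationComplex ρ₀).X₃ 1) (T₀ : Finset (Place K)),
      ∃ (x : galoisCohomology ρ₀ 1) (Tx : Finset (Place K)), T₀ ⊆ Tx ∧
        (∀ v : HeightOneSpectrum (𝓞 K), (Sum.inr v : Place K) ∉ Tx →
          galoisCohomology.localization ρ₀ (Sum.inr v) 1 x ∈ unramifiedSubgroup (GaloisRep.toLocal v ρ₀) 1) ∧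
        ∀ T' : Finset (Place K), Tx ⊆ T' →
          (∑ v ∈ T', Sum.elim
            (fun w : InfinitePlace K => zmodToQmodZ n
              (localTatePairingZMod (ρ₀.tateDual n) n (Sum.inl w) (LocalInvariants.canonical K n (Sum.inl w))
                (readout ρ₀ n hM (π (Sum.inl w)) f)
                (galoisCohomology.localization ((ρ₀.tateDual n).tateDual n) (Sum.inl w) 1
                  (galoisCohomology.map ι 1 x))))
            (fun v : HeightOneSpectrum (𝓞 K) =>
              haveI := moduleFinite_presModule₁ ρ₀
              haveI : CharZero (v.adicCompletion K) := charZero_of_algebra (K := K) (v.adicCompletion K);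
              - brauerInvariantEquiv (v.adicCompletion K)
                (cohomologyMap (toTopRepHom ((presModule₁ ρ₀).restrictField (v.adicCompletion K))
                    (DiscreteGaloisModule.units (v.adicCompletion K))
                    (equivariantMap ((presModule₁ ρ₀).restrictField (v.adicCompletion K))
                      (DiscreteGaloisModule.units (v.adicCompletion K))
                      (readoutInvariant (π (Sum.inr v)) (presentationComplex ρ₀).X₁ f))) 2
                  (galoisCohomology.res (presModule₁ ρ₀) (v.adicCompletion K) 2 ((pres_isSES ρ₀).δ₁ x))))
            v) = 0 →
          inv (ŷ.comp (boundary (presentationComplex_shortExact ρ₀) (classBarD K)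
            (f ≫ (ideleClassLimitShortComplex K).g)) (rfl : 1 + 1 = 2)) = 0) :
    ∀ (f : (presentationComplex ρ₀).X₁ ⟶ (ideleClassLimitShortComplex K).X₂)
      (ŷ : Abelian.Ext (triv (Γ := absoluteGaloisGroup K) ℤ) (presentationComplex ρ₀).X₃ 1) (T₀ : Finset (Place K)),
      ∃ (y : galoisCohomology ((ρ₀.tateDual n).tateDual n) 1) (Ty : Finset (Place K)), T₀ ⊆ Ty ∧
        (∀ v : HeightOneSpectrum (𝓞 K), (Sum.inr v : Place K) ∉ Ty →
          galoisCohomology.localization ((ρ₀.tateDual n).tateDual n) (Sum.inr v) 1 y ∈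
            unramifiedSubgroup (GaloisRep.toLocal v ((ρ₀.tateDual n).tateDual n)) 1) ∧
        ((∀ T' : Finset (Place K), Ty ⊆ T' →
            ∑ v ∈ T', localTatePairingZMod (ρ₀.tateDual n) n v (LocalInvariants.canonical K n v)
              (readout ρ₀ n hM (π v) f)
              (galoisCohomology.localization ((ρ₀.tateDual n).tateDual n) v 1 y) = 0) →
          inv (ŷ.comp (boundary (presentationComplex_shortExact ρ₀) (classBarD K)
            (f ≫ (ideleClassLimitShortComplex K).g)) (rfl : 1 + 1 = 2)) = 0) := by
  haveI := moduleFinite_presModule₁ ρ₀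
  haveI := moduleFinite_presModule₂ ρ₀
  refine hR4_of_localTerms_of_imp inv π ρ₀ hM κ hκ fun f ŷ T₀ => ?_
  obtain ⟨x, Tx, hT, hunr, himp⟩ := hE f ŷ T₀
  refine ⟨galoisCohomology.map ι 1 x, Tx, hT, fun v hv => localization_map_mem_unramifiedSubgroup_of_mem ι v (hunr v hv),
    fun T' hT' hzero => himp T' hT' ?_⟩
  rw [← hzero]
  refine Finset.sum_congr rfl ?_
  rintro (w | v) -
  · rfl
  · haveI : CharZero (v.adicCompletion K) := charZero_of_algebra (K := K) (v.adicCompletion K)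
    change -(brauerInvariantEquiv (v.adicCompletion K) _) = -(brauerInvariantEquiv (v.adicCompletion K) _)
    congr 3
    change galoisCohomology.res (presModule₁ ρ₀) (v.adicCompletion K) 2 ((pres_isSES ρ₀).δ₁ x) =
      (isSES_restrict (presModule₁ ρ₀) (presModule₂ ρ₀) ρ₀ (pres_isSES ρ₀) (K' := v.adicCompletion K)).δ₁
        (galoisCohomology.map (κ.restrictField (v.adicCompletion K)) 1
          (galoisCohomology.res ((ρ₀.tateDual n).tateDual n) (v.adicCompletion K) 1 (galoisCohomology.map ι 1 x)))
    rw [map_map_res_eq_res ρ₀ ι κ hκι, res_δ₁_presentation ρ₀ (v.adicCompletion K) x]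

/-- **THE NAMED FACT `hE` from: Tate duality for `(Γ_K, C̄, inv)`, an idèle projection family with the ASSEMBLY property,
and the SIGN-FREE E-side statement in global terms «local terms sum to `0` over every large `T'` ⟹
`inv(ŷ ∘ ∂(f ≫ g)) = 0`»** (for every biduality map `ι` with `ι m f = f m`).  HONEST FRAMING: a reduction.
[cite: MilneADT2006, Ch. I, Thm. 4.10(b) (proof, p. 58), Lemma 4.13, Thm. 1.8][cite: CasselsFrohlichANT1967, Ch. VII §11.2 (bis)] -/
theorem poitouTate_selmerStructure_duality_of_globalTerms_of_imp
    (hT : TateDualityHypotheses (classBarD K) inv) (π : ∀ v : Place K, IdeleProjection K v)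
    (hAsm : ∀ (n : ℕ) [NeZero n],
      ∀ ⦃M : Type⦄ [AddCommGroup M] [TopologicalSpace M] [DiscreteTopology M] [Finite M] [Finite (TateDual K M n)]
      (ρ₀ : DiscreteGaloisModule K M) (_hM : ∀ m : M, n • m = 0),
      ∀ (T : Finset (Place K))
        (h : ∀ v : Place K, (haveI := moduleFinite_presModule₁ ρ₀
          (homGaloisModule ((presModule₁ ρ₀).restrictField (Place.Completion v))
            (DiscreteGaloisModule.units (Place.Completion v))).toTopRep.ρ.invariants)),
        (∀ v : HeightOneSpectrum (𝓞 K), (Sum.inr v : Place K) ∉ T → ∀ x : LCarrier (presentationComplex ρ₀).X₁,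
          IsNonarchimedeanLocalField.ordQ (v.adicCompletion K)
            ((show LCarrier (presentationComplex ρ₀).X₁ →ₗ[ℤ] DiscreteGaloisModule.UnitsCarrier (v.adicCompletion K) from
              ((h (Sum.inr v)).1 : DiscreteRep.HomCarrier (LCarrier (presentationComplex ρ₀).X₁)
                (DiscreteGaloisModule.UnitsCarrier (v.adicCompletion K)))) x) = 0) →
        ∃ f : (presentationComplex ρ₀).X₁ ⟶ (ideleClassLimitShortComplex K).X₂, ∀ v : Place K,
          (haveI := moduleFinite_presModule₁ ρ₀; readoutInvariant (π v) (presentationComplex ρ₀).X₁ f) = h v)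
    (hE : ∀ (n : ℕ) [NeZero n],
      ∀ ⦃M : Type⦄ [AddCommGroup M] [TopologicalSpace M] [DiscreteTopology M] [Finite M] [Finite (TateDual K M n)]
      (ρ₀ : DiscreteGaloisModule K M) (hM : ∀ m : M, n • m = 0)
      (ι : ρ₀.toContRepresentation →ⁱL ((ρ₀.tateDual n).tateDual n).toContRepresentation),
      (∀ (m : M) (f : TateDual K M n), ι m f = f m) →
      ∀ (f : (presentationComplex ρ₀).X₁ ⟶ (ideleClassLimitShortComplex K).X₂)
        (ŷ : Abelian.Ext (triv (Γ := absoluteGaloisGroup K) ℤ) (presentationComplex ρ₀).X₃ 1) (T₀ : Finset (Place K)),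
        ∃ (x : galoisCohomology ρ₀ 1) (Tx : Finset (Place K)), T₀ ⊆ Tx ∧
          (∀ v : HeightOneSpectrum (𝓞 K), (Sum.inr v : Place K) ∉ Tx →
            galoisCohomology.localization ρ₀ (Sum.inr v) 1 x ∈ unramifiedSubgroup (GaloisRep.toLocal v ρ₀) 1) ∧
          ∀ T' : Finset (Place K), Tx ⊆ T' →
            (∑ v ∈ T', Sum.elim
              (fun w : InfinitePlace K => zmodToQmodZ n
                (localTatePairingZMod (ρ₀.tateDual n) n (Sum.inl w) (LocalInvariants.canonical K n (Sum.inl w))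
                  (readout ρ₀ n hM (π (Sum.inl w)) f)
                  (galoisCohomology.localization ((ρ₀.tateDual n).tateDual n) (Sum.inl w) 1
                    (galoisCohomology.map ι 1 x))))
              (fun v : HeightOneSpectrum (𝓞 K) =>
                haveI := moduleFinite_presModule₁ ρ₀
                haveI : CharZero (v.adicCompletion K) := charZero_of_algebra (K := K) (v.adicCompletion K);
                - brauerInvariantEquiv (v.adicCompletion K)
                  (cohomologyMap (toTopRepHom ((presModule₁ ρ₀).restrictField (v.adicCompletion K))
                      (DiscreteGaloisModule.units (v.adicCompletion K))
                      (equivariantMap ((presModule₁ ρ₀).restrictField (v.adicCompletion K))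
                        (DiscreteGaloisModule.units (v.adicCompletion K))
                        (readoutInvariant (π (Sum.inr v)) (presentationComplex ρ₀).X₁ f))) 2
                    (galoisCohomology.res (presModule₁ ρ₀) (v.adicCompletion K) 2 ((pres_isSES ρ₀).δ₁ x))))
              v) = 0 →
            inv (ŷ.comp (boundary (presentationComplex_shortExact ρ₀) (classBarD K)
              (f ≫ (ideleClassLimitShortComplex K).g)) (rfl : 1 + 1 = 2)) = 0) :
    poitouTate_selmerStructure_duality K := by
  refine poitouTate_selmerStructure_duality_of_assembly inv hT π hAsm fun n _ M _ _ _ _ _ ρ₀ hM => ?_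
  obtain ⟨ι, κ, hι, hκι, hικ⟩ := exists_bidual_intertwining (n := n) ρ₀ hM
  have hκ : ∀ (Φ : TateDual K (TateDual K M n) n) (f : TateDual K M n), Φ f = f (κ Φ) := fun Φ f => by
    conv_lhs => rw [← hικ Φ]
    exact hι (κ Φ) f
  exact hR4_of_globalTerms_of_imp inv π ρ₀ hM ι κ hκι hκ (hE n ρ₀ hM ι hι)

end Summit.BirchSwinnertonDyer.BirchSwinnertonDyer.Theorems.SchneiderFreeAdditiveX3.PoitouTateReduction

end
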